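import Mathlib.NumberTheory.Padics.RingHoms
import Mathlib.Analysis.Normed.Module.FiniteDimension
import Mathlib.Topology.Algebra.Module.FiniteDimension
import Mathlib.Analysis.Normed.Group.Ultra
import Mathlib.Data.ZMod.Basic
import Mathlib.Combinatorics.Pigeonhole
import HarnessLib

/-!
# The box principle with `p`-adic targets (Thue–Siegel "lemme de Siegel approché", ultrametric case)

Topic `Literature/NumberTheory/Transcendental` (namespace `Literature.NumberTheory.Transcendental`,
grouping sub-namespace `PadicBox`). Everything here is PROVED; no definitions, no named facts.

**Theorem** (`PadicBox.exists_small_int_combination`). Let `M` be a finite-dimensional ultrametric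
normed `ℚ_p`-vector space. There is a constant `a ∈ ℕ` (depending only on the norm of `M`) with the
following property: for all `U, N, Q, L ∈ ℕ` and vectors `e_{r,s} ∈ M` (`r < N`, `s < U`) of norm
`≤ 1`, if `p^{f (L + 2a) N} < (Q + 1)^U` (`f = dim_{ℚ_p} M`), then there are integers
`q₀, …, q_{U-1}`, not all zero, with `|q_s| ≤ Q` and `‖∑_s q_s e_{r,s}‖ ≤ p^{-L}` for every `r < N`.

This is Dirichlet's box principle run on the residues: the `(Q+1)^U` vectors `q ∈ [0, Q]^U` are
sorted according to the classes of the `N` sums `∑_s q_s e_{r,s}` (all of norm `≤ 1`) modulo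
`p^{L+2a}` in integral coordinates (`ℤ_p →+* ℤ/p^{L+2a}`, Mathlib `PadicInt.toZModPow`), of which
there are `p^{f(L+2a)N}`; two vectors in the same class differ by the required `q` (the loss `2a`
absorbs the two constants comparing `‖·‖_M` with the sup norm of coordinates in a basis, finite
dimension). It is the non-archimedean form of the "box principle" by which the auxiliary function
of the interpolation-free Gel'fond–Schneider method is made small directly on its Taylor
coefficients ([Waldschmidt1988, §6] after Waldschmidt, Invent. Math. 63 (1981), §3, Lemme 3.2 /
"Théorème 3.1.p"; the tree's complex analogue is `Waldschmidt1981.box_principle_complex`).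

## References

* [Waldschmidt1988] M. Waldschmidt, *On the transcendence methods of Gel'fond and Schneider in
  several variables*, New Advances in Transcendence Theory (A. Baker ed.), CUP 1988, 375–398, §6
  (p. 389) and its reference [15] = M. Waldschmidt, *Transcendance et exponentielles en plusieurs
  variables*, Invent. Math. 63 (1981) 97–127, §3.
* J. W. S. Cassels, *An Introduction to Diophantine Approximation*, Cambridge Tracts 45 (1957),
  Ch. V, Lemma 1 (Dirichlet's box principle for linear forms).
-/

noncomputable section

open Module

namespace Literature.NumberTheory.Transcendental

namespace PadicBox

variable {p : ℕ} [Fact p.Prime]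
variable {M : Type*} [NormedAddCommGroup M] [NormedSpace ℚ_[p] M] [FiniteDimensional ℚ_[p] M]

/-- **Comparison of `‖·‖_M` with integral coordinates.** There are `a ∈ ℕ` and a `ℚ_p`-linear
coordinate system `c : M → ℚ_p^f` (`f = dim M`, a linear equivalence) with `‖c(x)ᵢ‖ ≤ p^a ‖x‖` and
`‖x‖ ≤ p^a maxᵢ ‖c(x)ᵢ‖` (all norms on a finite-dimensional space over the complete field `ℚ_p` are
equivalent). [folklore] -/
theorem exists_coords :
    ∃ (a : ℕ) (c : M ≃ₗ[ℚ_[p]] (Fin (finrank ℚ_[p] M) → ℚ_[p])),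
      (∀ x i, ‖c x i‖ ≤ (p : ℝ) ^ a * ‖x‖) ∧ ∀ x, ‖x‖ ≤ (p : ℝ) ^ a * ‖c x‖ := by
  have hp : p.Prime := Fact.out
  have hp1 : (1 : ℝ) < p := by exact_mod_cast hp.one_lt
  let b := Module.finBasis ℚ_[p] M
  let c : M ≃L[ℚ_[p]] (Fin (finrank ℚ_[p] M) → ℚ_[p]) := b.equivFun.toContinuousLinearEquiv
  let T₁ : M →L[ℚ_[p]] (Fin (finrank ℚ_[p] M) → ℚ_[p]) := c
  let T₂ : (Fin (finrank ℚ_[p] M) → ℚ_[p]) →L[ℚ_[p]] M := c.symm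
  have h1 : ∀ x, ‖c x‖ ≤ ‖T₁‖ * ‖x‖ := fun x => T₁.le_opNorm x
  have h2 : ∀ y, ‖c.symm y‖ ≤ ‖T₂‖ * ‖y‖ := fun y => T₂.le_opNorm y
  obtain ⟨a, ha⟩ := pow_unbounded_of_one_lt (max ‖T₁‖ ‖T₂‖) hp1
  have ha1 : ‖T₁‖ ≤ (p : ℝ) ^ a := (le_max_left ‖T₁‖ ‖T₂‖).trans ha.le
  have ha2 : ‖T₂‖ ≤ (p : ℝ) ^ a := (le_max_right ‖T₁‖ ‖T₂‖).trans ha.le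
  refine ⟨a, b.equivFun, fun x i => ?_, fun x => ?_⟩
  · calc ‖b.equivFun x i‖ ≤ ‖b.equivFun x‖ := norm_le_pi_norm _ i
      _ = ‖c x‖ := rfl
      _ ≤ ‖T₁‖ * ‖x‖ := h1 x
      _ ≤ (p : ℝ) ^ a * ‖x‖ := mul_le_mul_of_nonneg_right ha1 (norm_nonneg _)
  · calc ‖x‖ = ‖c.symm (c x)‖ := by simp
      _ ≤ ‖T₂‖ * ‖c x‖ := h2 _
      _ ≤ (p : ℝ) ^ a * ‖b.equivFun x‖ := mul_le_mul_of_nonneg_right ha2 (norm_nonneg _)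

/-- **Congruent `p`-adic integers are close**: if `z ≡ z' (mod p^n)` in `ℤ_p` then
`‖z − z'‖ ≤ p^{-n}`. [folklore] -/
theorem norm_sub_le_of_toZModPow_eq {n : ℕ} {z z' : ℤ_[p]}
    (h : PadicInt.toZModPow n z = PadicInt.toZModPow n z') : ‖z - z'‖ ≤ (p : ℝ) ^ (-(n : ℤ)) := by
  have hker : z - z' ∈ RingHom.ker (PadicInt.toZModPow n) := by
    rw [RingHom.mem_ker, map_sub, h, sub_self]
  rw [PadicInt.ker_toZModPow] at hker
  exact (PadicInt.norm_le_pow_iff_mem_span_pow _ n).2 hker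

/-- **The box principle with `p`-adic targets.** For a finite-dimensional ultrametric normed
`ℚ_p`-space `M` there is `a ∈ ℕ` such that: for all `U N Q L` and `e : Fin N → Fin U → M` with
`‖e r s‖ ≤ 1`, if `p^{f(L+2a)N} < (Q+1)^U` (`f = dim M`) then some `q ∈ ℤ^U ∖ 0` with `|q_s| ≤ Q`
has `‖∑_s q_s e_{r,s}‖ ≤ p^{-L}` for every `r`.
[cite: Waldschmidt1988, §6 (p. 389); Waldschmidt 1981 (Invent. Math. 63) §3] -/
theorem exists_small_int_combination [IsUltrametricDist M] :
    ∃ a : ℕ, ∀ (U N Q L : ℕ) (e : Fin N → Fin U → M), (∀ r s, ‖e r s‖ ≤ 1) →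
      p ^ (finrank ℚ_[p] M * (L + 2 * a) * N) < (Q + 1) ^ U →
      ∃ q : Fin U → ℤ, q ≠ 0 ∧ (∀ s, |q s| ≤ Q) ∧
        ∀ r, ‖∑ s, (q s : ℚ_[p]) • e r s‖ ≤ (p : ℝ) ^ (-(L : ℤ)) := by
  classical
  have hp : p.Prime := Fact.out
  have hp0 : (0 : ℝ) < p := by exact_mod_cast hp.pos
  have hp1 : (1 : ℝ) ≤ p := by exact_mod_cast hp.one_lt.le
  obtain ⟨a, c, hc1, hc2⟩ := exists_coords (p := p) (M := M)
  refine ⟨a, fun U N Q L e he hcard => ?_⟩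
  -- the sums over the box have norm `≤ 1`
  let x : (Fin U → Fin (Q + 1)) → Fin N → M := fun q r => ∑ s, ((q s : ℕ) : ℚ_[p]) • e r s
  have hx : ∀ q r, ‖x q r‖ ≤ 1 := by
    intro q r
    refine IsUltrametricDist.norm_sum_le_of_forall_le_of_nonneg zero_le_one fun s _ => ?_
    rw [norm_smul]
    calc ‖((q s : ℕ) : ℚ_[p])‖ * ‖e r s‖ ≤ 1 * 1 := by
          gcongr
          · exact_mod_cast Padic.norm_int_le_one (p := p) ((q s : ℕ) : ℤ)
          · exact he r s
      _ = 1 := one_mul 1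
  -- the coordinates scaled by `p^a` are `p`-adic integers
  have hint : ∀ q r i, ‖(p : ℚ_[p]) ^ a * c (x q r) i‖ ≤ 1 := by
    intro q r i
    rw [norm_mul, Padic.norm_p_pow]
    calc (p : ℝ) ^ (-(a : ℤ)) * ‖c (x q r) i‖ ≤ (p : ℝ) ^ (-(a : ℤ)) * ((p : ℝ) ^ a * ‖x q r‖) :=
          mul_le_mul_of_nonneg_left (hc1 _ i) (by positivity)
      _ ≤ (p : ℝ) ^ (-(a : ℤ)) * ((p : ℝ) ^ a * 1) := by gcongr; exact hx q r
      _ = 1 := by rw [mul_one, zpow_neg, zpow_natCast, inv_mul_cancel₀ (by positivity)]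
  -- the class map
  let Ψ : (Fin U → Fin (Q + 1)) → Fin N → Fin (finrank ℚ_[p] M) → ZMod (p ^ (L + 2 * a)) :=
    fun q r i => PadicInt.toZModPow (L + 2 * a) ⟨(p : ℚ_[p]) ^ a * c (x q r) i, hint q r i⟩
  -- counting
  haveI : NeZero (p ^ (L + 2 * a)) := ⟨pow_ne_zero _ hp.ne_zero⟩
  have hcard' : Fintype.card (Fin N → Fin (finrank ℚ_[p] M) → ZMod (p ^ (L + 2 * a))) <
      Fintype.card (Fin U → Fin (Q + 1)) := by
    simp only [Fintype.card_fun, Fintype.card_fin, ZMod.card]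
    calc ((p ^ (L + 2 * a)) ^ finrank ℚ_[p] M) ^ N = p ^ (finrank ℚ_[p] M * (L + 2 * a) * N) := by
          rw [← pow_mul, ← pow_mul]; ring_nf
      _ < (Q + 1) ^ U := hcard
  obtain ⟨q₁, q₂, hne, heq⟩ := Fintype.exists_ne_map_eq_of_card_lt Ψ hcard'
  -- the difference
  refine ⟨fun s => (q₁ s : ℤ) - (q₂ s : ℤ), ?_, fun s => ?_, fun r => ?_⟩
  · intro h0
    apply hne
    funext s
    have := congrFun h0 s
    simp only [Pi.zero_apply, sub_eq_zero, Nat.cast_inj] at this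
    exact Fin.ext this
  · dsimp only
    have h1 : ((q₁ s : ℕ) : ℤ) ≤ Q := by exact_mod_cast Nat.lt_succ_iff.1 (q₁ s).2
    have h2 : ((q₂ s : ℕ) : ℤ) ≤ Q := by exact_mod_cast Nat.lt_succ_iff.1 (q₂ s).2
    have h3 : (0 : ℤ) ≤ ((q₁ s : ℕ) : ℤ) := by positivity
    have h4 : (0 : ℤ) ≤ ((q₂ s : ℕ) : ℤ) := by positivity
    rw [abs_le]
    constructor <;> linarith
  · -- `∑ q_s e_{r,s} = x q₁ r - x q₂ r`
    have hsum : ∑ s, (((q₁ s : ℤ) - (q₂ s : ℤ) : ℤ) : ℚ_[p]) • e r s = x q₁ r - x q₂ r := by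
      simp only [x, ← Finset.sum_sub_distrib, ← sub_smul]
      refine Finset.sum_congr rfl fun s _ => ?_
      push_cast
      ring_nf
    rw [hsum]
    -- coordinates of the difference are small
    have hΨ : ∀ i, ‖c (x q₁ r) i - c (x q₂ r) i‖ ≤ (p : ℝ) ^ (-((L + a : ℕ) : ℤ)) := by
      intro i
      have h := congrFun (congrFun heq r) i
      have h' := norm_sub_le_of_toZModPow_eq h
      rw [PadicInt.norm_def, PadicInt.coe_sub] at h'
      change ‖(p : ℚ_[p]) ^ a * c (x q₁ r) i - (p : ℚ_[p]) ^ a * c (x q₂ r) i‖ ≤ _ at h'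
      rw [← mul_sub, norm_mul, Padic.norm_p_pow] at h'
      calc ‖c (x q₁ r) i - c (x q₂ r) i‖
          = (p : ℝ) ^ (a : ℤ) * ((p : ℝ) ^ (-(a : ℤ)) * ‖c (x q₁ r) i - c (x q₂ r) i‖) := by
            rw [← mul_assoc, ← zpow_add₀ hp0.ne', add_neg_cancel, zpow_zero, one_mul]
        _ ≤ (p : ℝ) ^ (a : ℤ) * (p : ℝ) ^ (-((L + 2 * a : ℕ) : ℤ)) :=
            mul_le_mul_of_nonneg_left h' (by positivity)
        _ = (p : ℝ) ^ (-((L + a : ℕ) : ℤ)) := by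
            rw [← zpow_add₀ hp0.ne']
            congr 1
            push_cast
            ring
    calc ‖x q₁ r - x q₂ r‖ ≤ (p : ℝ) ^ a * ‖c (x q₁ r - x q₂ r)‖ := hc2 _
      _ ≤ (p : ℝ) ^ a * (p : ℝ) ^ (-((L + a : ℕ) : ℤ)) := by
          refine mul_le_mul_of_nonneg_left ?_ (by positivity)
          refine (pi_norm_le_iff_of_nonneg (by positivity)).2 fun i => ?_
          rw [map_sub]
          exact hΨ i
      _ = (p : ℝ) ^ (-(L : ℤ)) := by
          rw [← zpow_natCast, ← zpow_add₀ hp0.ne']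
          congr 1
          push_cast
          ring

end PadicBox

end Literature.NumberTheory.Transcendental
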